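import Summits.ResolutionOfSingularities.ResolutionOfSingularities.Theorems.RelativeDeltaCutClasses
import Summits.ResolutionOfSingularities.ResolutionOfSingularities.Theorems.DeltaFaceCutKernels
import HarnessLib

/-!
# RelativeDeltaCutKernels — §6 of the decomp-res node «RelativeDeltaCut» (lens-2 g12, sha256 29d33530a35d7692;
critic row 85 CLEARED)

Tree file 2/3, route-independent: the pure-logic kernels among the classes — pointwise EXHAUSTION
`classGE_or_gen_or_rspecial`, the projections of a relatively special point, the EXACT cut `seqDimFour_one_iff :
SeqDimFour 1 n ⟺ SeqRGen n ∧ SeqRSpec n`, the comparison edges with g10 `VeryNearCutClasses.SeqNGen/SeqNSpec` and g11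
`DeltaFaceCutClasses.SeqDGen/SeqDSpec/SeqDSpecNonIso`, the isolation sub-cut `seqRSpec_iff_iso`, the NEW sub-cut of the
non-isolated column `seqRSpecNonIso_iff : SeqRSpecNonIso n ⟺ SeqRSpecCurve n ∧ SeqRSpecTangle n`, the three
ENGINES at a point
and `rGenRungAt_of_engines`, `rGenRungAt_one`, `relGenericRung_of_engines` — VERBATIM (0 sorry).
(Sources: CossartJannsenSaito2020 Thm. 2.14, §§5–9; Hironaka1964; BenitoVillamayor2013; CossartPiltant2019.)
-/

open CategoryTheory AlgebraicGeometry TopologicalSpace IsLocalRing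
open Literature.AlgebraicGeometry.Resolution
open Summit.ResolutionOfSingularities.ResolutionOfSingularities.Theorems
open Summit.ResolutionOfSingularities.ResolutionOfSingularities.Theorems.WeakOrderReduction
open Summit.ResolutionOfSingularities.ResolutionOfSingularities.Theorems.DeltaFaceCutClasses

namespace Summit.ResolutionOfSingularities.ResolutionOfSingularities.Theorems.RelativeDeltaCut

/-! ## §6  Kernels — pure logic (0 sorry) -/

section Kernels

/-- g11's point package is the curve package over the singleton (sanity, definitional; moved here from §3 by the writer). [folklore] -/
theorem packageExitsAt_iff_over {Y : Scheme.{0}} (I : Y.IdealSheafData) (n : ℕ) (y : Y) :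
    PackageExitsAt I n y ↔ PackageExitsOver I n ({y} : Set Y) := Iff.rfl


variable {n : ℕ}

/-- Pointwise EXHAUSTION: a top point is of class ≥ 2, near-generic, δ-generic or curve-generic — or relatively special.
[folklore] -/
theorem classGE_or_gen_or_rspecial {k : Type} [Field k] {Y : Scheme.{0}} (g : Y ⟶ Spec (.of k))
    (hY : Scheme.IsRegular Y) (I : Y.IdealSheafData) (n : ℕ) (y : Y) :
    (ClassGE g hY I n 2 y ∨ VeryNearCutClasses.IsNearGenericPt I n y ∨ IsDeltaGenericPt I n y ∨
        IsCurveGenericPt I n y) ∨ IsRelSpecialPt g hY I n y := by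
  by_cases h1 : ClassGE g hY I n 2 y
  · exact Or.inl (Or.inl h1)
  by_cases h2 : VeryNearCutClasses.IsNearGenericPt I n y
  · exact Or.inl (Or.inr (Or.inl h2))
  by_cases h3 : IsDeltaGenericPt I n y
  · exact Or.inl (Or.inr (Or.inr (Or.inl h3)))
  by_cases h4 : IsCurveGenericPt I n y
  · exact Or.inl (Or.inr (Or.inr (Or.inr h4)))
  · exact Or.inr ⟨⟨h1, h2⟩, h3, h4⟩

/-- A relatively special point is in none of the four decided classes. [folklore] -/
theorem not_gen_of_isRelSpecialPt {k : Type} [Field k] {Y : Scheme.{0}} {g : Y ⟶ Spec (.of k)}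
    {hY : Scheme.IsRegular Y} {I : Y.IdealSheafData} {n : ℕ} {y : Y} (h : IsRelSpecialPt g hY I n y) :
    ¬ (ClassGE g hY I n 2 y ∨ VeryNearCutClasses.IsNearGenericPt I n y ∨ IsDeltaGenericPt I n y ∨
        IsCurveGenericPt I n y) := by
  rintro (hc | hg | hd | hu)
  · exact h.1.1 hc
  · exact h.1.2 hg
  · exact h.2.1 hd
  · exact h.2.2 hu

/-- A relatively special point is near-special (g10, tree) — projection. [folklore] -/
theorem isNearSpecialPt_of_isRelSpecialPt {k : Type} [Field k] {Y : Scheme.{0}} {g : Y ⟶ Spec (.of k)}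
    {hY : Scheme.IsRegular Y} {I : Y.IdealSheafData} {n : ℕ} {y : Y} (h : IsRelSpecialPt g hY I n y) :
    VeryNearCutClasses.IsNearSpecialPt g hY I n y :=
  h.1

/-- A relatively special point is face-special (g9, tree). [folklore] -/
theorem isFaceSpecialPt_of_isRelSpecialPt {k : Type} [Field k] {Y : Scheme.{0}} {g : Y ⟶ Spec (.of k)}
    {hY : Scheme.IsRegular Y} {I : Y.IdealSheafData} {n : ℕ} {y : Y} (h : IsRelSpecialPt g hY I n y) :
    FaceFormCutClasses.IsFaceSpecialPt g hY I n y :=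
  VeryNearCutKernels.isFaceSpecialPt_of_isNearSpecialPt h.1

/-- A relatively special point is δ-special (g11, restated). [folklore] -/
theorem isDeltaSpecialPt_of_isRelSpecialPt {k : Type} [Field k] {Y : Scheme.{0}} {g : Y ⟶ Spec (.of k)}
    {hY : Scheme.IsRegular Y} {I : Y.IdealSheafData} {n : ℕ} {y : Y} (h : IsRelSpecialPt g hY I n y) :
    IsDeltaSpecialPt g hY I n y :=
  ⟨isFaceSpecialPt_of_isRelSpecialPt h, h.2.1⟩

/-- **EXACT at each marking**: `SeqDimFour 1 n ⟺ SeqRGen n ∧ SeqRSpec n` (excluded middle on «some top point is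
relatively special»). [folklore] -/
theorem seqDimFour_one_iff : SeqDimFour 1 n ↔ SeqRGen n ∧ SeqRSpec n := by
  constructor
  · intro h
    refine ⟨?_, ?_⟩
    · intro p hp k _ _ Y g h1 h2 h3 hY h4 I hord _
      exact h p hp k Y g h1 h2 h3 hY h4 I hord (fun y _ => Or.inl le_rfl)
    · intro p hp k _ _ Y g h1 h2 h3 hY h4 I hord _
      exact h p hp k Y g h1 h2 h3 hY h4 I hord (fun y _ => Or.inl le_rfl)
  · rintro ⟨hG, hS⟩ p hp k _ _ Y g h1 h2 h3 hY h4 I hord _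
    by_cases hex : ∃ y : Y, idealOrder I y = ((n : ℕ) : ℕ∞) ∧ IsRelSpecialPt g hY I n y
    · exact hS p hp k Y g h1 h2 h3 hY h4 I hord hex
    · refine hG p hp k Y g h1 h2 h3 hY h4 I hord ?_
      intro y hy
      rcases classGE_or_gen_or_rspecial g hY I n y with h | h
      · exact h
      · exact absurd ⟨y, hy, h⟩ hex

/-- The two classes at one marking give all data. [folklore] -/
theorem seqDimFour_one_of_rgen_rspec (hG : SeqRGen n) (hS : SeqRSpec n) : SeqDimFour 1 n :=
  seqDimFour_one_iff.mpr ⟨hG, hS⟩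

/-- `SeqRGen n` is `SeqDimFour 1 n` restricted: weaker BY LETTER. [folklore] -/
theorem seqRGen_of_seqDimFour_one (h : SeqDimFour 1 n) : SeqRGen n := (seqDimFour_one_iff.mp h).1

/-- `SeqRSpec n` is `SeqDimFour 1 n` restricted: weaker BY LETTER. [folklore] -/
theorem seqRSpec_of_seqDimFour_one (h : SeqDimFour 1 n) : SeqRSpec n := (seqDimFour_one_iff.mp h).2

/-- `SeqDimFour 2 n` is `SeqRGen n` restricted. [folklore] -/
theorem seqDimFour_two_of_seqRGen (h : SeqRGen n) : SeqDimFour 2 n := by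
  intro p hp k _ _ Y g h1 h2 h3 hY h4 I hord hcls
  exact h p hp k Y g h1 h2 h3 hY h4 I hord (fun y hy => Or.inl (hcls y hy))

/-- g10's decided schema `SeqNGen n` (tree) is `SeqRGen n` restricted (the curve-generic and δ-generic classes ENLARGE
the decided class). [folklore] -/
theorem seqNGen_of_seqRGen (h : SeqRGen n) : VeryNearCutClasses.SeqNGen n := by
  intro p hp k _ _ Y g h1 h2 h3 hY h4 I hord hcls
  refine h p hp k Y g h1 h2 h3 hY h4 I hord ?_
  intro y hy
  rcases hcls y hy with h' | h'
  · exact Or.inl h'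
  · exact Or.inr (Or.inl h')

/-- g11's decided schema `SeqDGen n` (restated) is `SeqRGen n` restricted (face-generic ⇒ near-generic, tree kernel
`VeryNearCutKernels.isNearGenericPt_of_isFaceGenericPt`). [folklore] -/
theorem seqDGen_of_seqRGen (h : SeqRGen n) : SeqDGen n := by
  intro p hp k _ _ Y g h1 h2 h3 hY h4 I hord hcls
  refine h p hp k Y g h1 h2 h3 hY h4 I hord ?_
  intro y hy
  rcases hcls y hy with (h' | h') | h'
  · exact Or.inl h'
  · exact Or.inr (Or.inl (VeryNearCutKernels.isNearGenericPt_of_isFaceGenericPt h'))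
  · exact Or.inr (Or.inr (Or.inl h'))

/-- g10's located schema `SeqNSpec n` (tree) gives `SeqRSpec n` (relatively special ⇒ near-special): the located class
SHRINKS by letter. [folklore] -/
theorem seqRSpec_of_seqNSpec (h : VeryNearCutClasses.SeqNSpec n) : SeqRSpec n := by
  intro p hp k _ _ Y g h1 h2 h3 hY h4 I hord hex
  obtain ⟨y, hy, hs⟩ := hex
  exact h p hp k Y g h1 h2 h3 hY h4 I hord ⟨y, hy, hs.1⟩

/-- g11's located schema `SeqDSpec n` (restated) gives `SeqRSpec n` (relatively special ⇒ δ-special). [folklore] -/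
theorem seqRSpec_of_seqDSpec (h : SeqDSpec n) : SeqRSpec n := by
  intro p hp k _ _ Y g h1 h2 h3 hY h4 I hord hex
  obtain ⟨y, hy, hs⟩ := hex
  exact h p hp k Y g h1 h2 h3 hY h4 I hord ⟨y, hy, isDeltaSpecialPt_of_isRelSpecialPt hs⟩

/-- g11's NON-ISOLATED column gives this node's (the column this node cuts SHRINKS by letter). [folklore] -/
theorem seqRSpecNonIso_of_seqDSpecNonIso (h : SeqDSpecNonIso n) : SeqRSpecNonIso n := by
  intro p hp k _ _ Y g h1 h2 h3 hY h4 I hord hex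
  obtain ⟨y, hy, hs, hni⟩ := hex
  exact h p hp k Y g h1 h2 h3 hY h4 I hord ⟨y, hy, isDeltaSpecialPt_of_isRelSpecialPt hs, hni⟩

/-- **EXACT isolation sub-cut of the located class**: `SeqRSpec n ⟺ SeqRSpecNonIso n ∧ SeqRSpecIso n`. [folklore] -/
theorem seqRSpec_iff_iso : SeqRSpec n ↔ SeqRSpecNonIso n ∧ SeqRSpecIso n := by
  constructor
  · intro h
    refine ⟨?_, ?_⟩
    · intro p hp k _ _ Y g h1 h2 h3 hY h4 I hord hex
      obtain ⟨y, hy, hs, -⟩ := hex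
      exact h p hp k Y g h1 h2 h3 hY h4 I hord ⟨y, hy, hs⟩
    · intro p hp k _ _ Y g h1 h2 h3 hY h4 I hord hex _
      exact h p hp k Y g h1 h2 h3 hY h4 I hord hex
  · rintro ⟨hN, hI⟩ p hp k _ _ Y g h1 h2 h3 hY h4 I hord hex
    by_cases hni : ∃ y : Y, idealOrder I y = ((n : ℕ) : ℕ∞) ∧ IsRelSpecialPt g hY I n y ∧
        ¬ FaceFormCutClasses.IsIsolatedTop I n y
    · exact hN p hp k Y g h1 h2 h3 hY h4 I hord hni
    · refine hI p hp k Y g h1 h2 h3 hY h4 I hord hex ?_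
      intro y hy hs
      by_contra hiso
      exact hni ⟨y, hy, hs, hiso⟩

/-- The two isolation columns give the located class (`mpr`, by name for probes). [folklore] -/
theorem seqRSpec_of_iso (hN : SeqRSpecNonIso n) (hI : SeqRSpecIso n) : SeqRSpec n :=
  seqRSpec_iff_iso.mpr ⟨hN, hI⟩

/-- **EXACT sub-cut of the NON-ISOLATED column (NEW)**: `SeqRSpecNonIso n ⟺ SeqRSpecCurve n ∧ SeqRSpecTangle n`
(excluded middle on «some non-isolated relatively special top point lies on a clean curve»). [folklore] -/
theorem seqRSpecNonIso_iff : SeqRSpecNonIso n ↔ SeqRSpecCurve n ∧ SeqRSpecTangle n := by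
  constructor
  · intro h
    refine ⟨?_, ?_⟩
    · intro p hp k _ _ Y g h1 h2 h3 hY h4 I hord hex
      obtain ⟨y, hy, hs, hni, -⟩ := hex
      exact h p hp k Y g h1 h2 h3 hY h4 I hord ⟨y, hy, hs, hni⟩
    · intro p hp k _ _ Y g h1 h2 h3 hY h4 I hord hex _
      exact h p hp k Y g h1 h2 h3 hY h4 I hord hex
  · rintro ⟨hC, hT⟩ p hp k _ _ Y g h1 h2 h3 hY h4 I hord hex
    by_cases hcur : ∃ y : Y, idealOrder I y = ((n : ℕ) : ℕ∞) ∧ IsRelSpecialPt g hY I n y ∧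
        ¬ FaceFormCutClasses.IsIsolatedTop I n y ∧ OnCleanCurve I n y
    · exact hC p hp k Y g h1 h2 h3 hY h4 I hord hcur
    · refine hT p hp k Y g h1 h2 h3 hY h4 I hord hex ?_
      intro y hy hs hni hcl
      exact hcur ⟨y, hy, hs, hni, hcl⟩

/-- The two strata give the non-isolated column (`mpr`, by name for probes). [folklore] -/
theorem seqRSpecNonIso_of_strata (hC : SeqRSpecCurve n) (hT : SeqRSpecTangle n) : SeqRSpecNonIso n :=
  seqRSpecNonIso_iff.mpr ⟨hC, hT⟩

/-- The located class from its three leaves: CURVE, TANGLE, ISO. [folklore] -/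
theorem seqRSpec_of_leaves (hC : SeqRSpecCurve n) (hT : SeqRSpecTangle n) (hI : SeqRSpecIso n) : SeqRSpec n :=
  seqRSpec_of_iso (seqRSpecNonIso_of_strata hC hT) hI

/-- ENGINE AT A POINT (i): the tree engine `VeryNearExit` makes a near-generic point a class-2-form exit point. [folklore] -/
theorem isNearExitPt_of_isNearGenericPt {Y : Scheme.{0}} {I : Y.IdealSheafData} {n : ℕ} {y : Y}
    (hV : VeryNearCutClasses.VeryNearExit) (hY : Scheme.IsRegular Y) (hn : 2 ≤ n)
    (h : VeryNearCutClasses.IsNearGenericPt I n y) : VeryNearCutClasses.IsNearExitPt I n y := by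
  obtain ⟨hcl, hiso, d, c, hc, hfr, hface⟩ := h
  exact ⟨hcl, hiso, d, c, hc, hfr, hV Y I n hn y (hY y) d c hc hfr hface⟩

/-- ENGINE AT A POINT (ii): g11's engine `DeltaPackageExit` makes a δ-generic top point a package-exit point. [folklore] -/
theorem isPackageExitPt_of_isDeltaGenericPt {Y : Scheme.{0}} {I : Y.IdealSheafData} {n : ℕ} {y : Y}
    (hD : DeltaPackageExit) (hY : Scheme.IsRegular Y) (hn : 2 ≤ n) (hy : idealOrder I y = ((n : ℕ) : ℕ∞))
    (h : IsDeltaGenericPt I n y) : IsPackageExitPt I n y := by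
  obtain ⟨hcl, hiso, d, c, hc, hfr, a, b, F, hface, hgen⟩ := h
  exact ⟨hcl, hiso, hD Y hY I n hn y hcl hy d c hc hfr a b F hface hgen⟩

/-- ENGINE AT A POINT (iii): the NEW engine `UniformCurvePackageExit` makes a curve-generic point a curve-exit point.
[folklore] -/
theorem isCurveExitPt_of_isCurveGenericPt {Y : Scheme.{0}} {I : Y.IdealSheafData} {n : ℕ} {y : Y}
    (hU : UniformCurvePackageExit) (hY : Scheme.IsRegular Y) (hn : 2 ≤ n) (h : IsCurveGenericPt I n y) :
    IsCurveExitPt I n y := by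
  obtain ⟨η, a, b, hηy, hiso, hcurve⟩ := h
  exact ⟨η, hηy, hcurve.1, hiso, hU Y hY I n hn η a b hcurve⟩

/-- **THE ENGINES AT WORK (pure logic given the typed pieces)**: the tree engine `VeryNearExit`, g11's engine
`DeltaPackageExit`, the NEW engine `UniformCurvePackageExit`, and the engine-free port `CurvePackagePort n` give
`RGenRungAt n` for `n ≥ 2`. [folklore] -/
theorem rGenRungAt_of_engines (hV : VeryNearCutClasses.VeryNearExit) (hD : DeltaPackageExit)
    (hU : UniformCurvePackageExit) (hP : CurvePackagePort n) (hn : 2 ≤ n) : RGenRungAt n := by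
  intro h2 p hp k _ _ Y g hg1 hg2 hg3 hY h4 I hord hcls
  refine hP h2 p hp k Y g hg1 hg2 hg3 hY h4 I hord ?_
  intro y hy
  rcases hcls y hy with h | h | h | h
  · exact Or.inl h
  · exact Or.inr (Or.inl (isNearExitPt_of_isNearGenericPt hV hY hn h))
  · exact Or.inr (Or.inr (Or.inl (isPackageExitPt_of_isDeltaGenericPt hD hY hn hy h)))
  · exact Or.inr (Or.inr (Or.inr (isCurveExitPt_of_isCurveGenericPt hU hY hn h)))

/-- At marking `1` every top point is a contact point (tree port `OrderOneContact`), hence of class ≥ 2: `RGenRungAt 1`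
with no blow-up at all. [folklore] -/
theorem rGenRungAt_one (h1 : FaceFormCutClasses.OrderOneContact) : RGenRungAt 1 := by
  intro h2 p hp k _ _ Y g hg1 hg2 hg3 hY h4 I hord _
  refine h2 p hp k Y g hg1 hg2 hg3 hY h4 I hord ?_
  intro y hy
  exact Or.inr (Or.inl (h1 p hp k Y g hg1 hg2 hg3 hY I y hy))

/-- **`RelGenericRung` is DECIDED modulo the typed pieces**: three engines, the curve port at every marking `≥ 2`, and
the order-one contact port. [folklore] -/
theorem relGenericRung_of_engines (hV : VeryNearCutClasses.VeryNearExit) (hD : DeltaPackageExit)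
    (hU : UniformCurvePackageExit) (hP : ∀ n : ℕ, 2 ≤ n → CurvePackagePort n)
    (h1 : FaceFormCutClasses.OrderOneContact) : RelGenericRung := by
  intro hE2 n hn
  by_cases h : 2 ≤ n
  · exact rGenRungAt_of_engines hV hD hU (hP n h) h (hE2 n hn)
  · have hn1 : n = 1 := by omega
    subst hn1
    exact rGenRungAt_one h1 (hE2 1 hn)


end Kernels

end Summit.ResolutionOfSingularities.ResolutionOfSingularities.Theorems.RelativeDeltaCut
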